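import Mathlib
import Summits.NavierStokesRegularity.NavierStokesRegularity.Theorems.FilamentSkeletonRssStadiumSegmentPiece
import Summits.NavierStokesRegularity.NavierStokesRegularity.Theorems.FilamentSkeletonRssStadiumChordPerturb
import Summits.NavierStokesRegularity.NavierStokesRegularity.Theorems.FilamentSkeletonRssStadiumPartnerPiece

/-!
# Route `FilamentSkeletonRss` · cruxes `SkeletonJ1L` (stmt-NavierStokesRegularity-23296, registered stub `stub_tangentSkeletonL` ≡
# `TangentSkeletonNearStraightL`, stmt-23320) · line `child_tangent_analytic_strip_L` (b0b56c52900dd90a), stub `stub_stripPropagation` —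
# brick for the freeze step of `rcore`: A FROZEN COMPLEX SEGMENT OF THE ANCHOR'S TENT IS UNIFORMLY MARGINED, HOLOMORPHIC AND BOUNDED
# ON A BALL OF TARGETS AROUND THE ANCHOR, FROM POINTWISE POSITIVITY AT THE ANCHOR ALONE

The quarter-width corner certificates (`Theorems.StadiumCornerRightNear/…DescentMid/…DescentFar`, `Theorems.StadiumCornerLeft`,
`Theorems.StadiumPlateauShortChord`, …) are stated in POSITIVITY form at ONE target `z₀` (the anchor of the tent):
`0 < Re(Σᵢ (Fᵢ z₀ − Fᵢ ζ)² + κ·G ζ)` for every source `ζ` of a given straight piece `[p, q]` of the tent of `z₀`.  The freeze step of the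
right-half quarter core `rcore` (`Theorems.StadiumStripPropagationRightHalf.stripPropagation_of_rightHalfCore`) reuses the tent of `z₀` for all
targets `z` of a small ball; this file packages, once for every complex segment, the passage
  pointwise positivity at the anchor ⟹ (compactness of `[0,1]`) a uniform margin `m` at the anchor (`anchor_margin_pos`)
  ⟹ (`Theorems.StadiumChordPerturb.re_chord_sq_core_ge_of_near`, explicit radius) the margin `m/2` for all targets of a ball `B(z₀, δ) ⊆ S`
  ⟹ (`Theorems.StadiumSegmentPiece`) the frozen piece `z ↦ ∫_{t∈[0,1]} ((Σᵢ (Fᵢ z − Fᵢ(γ t))² + κ G(γ t))^{3/2})⁻¹ • (((q−p)•F′(γ t)) ⨯₃ (F z − F(γ t))) dt`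
  is holomorphic on `B(z₀, δ)` and bounded there by `(m/2)^{-3/2}·2·(‖q − p‖M)·(M(1 + ‖z₀ − p‖ + ‖q − p‖))`
(`frozenSegment_nhds`).  Only the stadium `S = {|Im| < hs, |Re − cc| < L + hs}`, `F` holomorphic on `S` with `‖F′‖ ≤ M`, `G` continuous on `S`,
the segment inside `S` and the anchor in `S` are used — no numbers, no tangent-oscillation input; the quantitative margins are needed only for
the bound on the target's OWN tent, not for holomorphy.
HONEST FRAMING: a brick for a plan about a HYPOTHETICAL filament skeleton on the NEGATIVE side of a MODEL route; the stub `stub_stripPropagation`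
is NOT closed by this file, `TangentSkeletonNearStraightL` / `SkeletonJ1L` stay OPEN; nothing here bears on Navier–Stokes regularity or blow-up.
`--supports stmt-NavierStokesRegularity-23296` (stub `stub_tangentSkeletonL` ≡ item 23320).
-/

set_option linter.dupNamespace false

noncomputable section

namespace Summit.NavierStokesRegularity.NavierStokesRegularity.Theorems.StadiumFrozenSegmentNhds

open Set Filter Topology Complex MeasureTheory Metric
open scoped Matrix
open Summit.NavierStokesRegularity.NavierStokesRegularity.Theorems.StadiumSegmentPiece
open Summit.NavierStokesRegularity.NavierStokesRegularity.Theorems.StadiumChordPerturb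
open Summit.NavierStokesRegularity.NavierStokesRegularity.Theorems.StadiumPartnerPiece

/-- **Pointwise positivity at the anchor along a compact segment gives a uniform margin.**  `F` holomorphic and `G` continuous on the
stadium `S`, a source segment `t ↦ p + t(q − p)`, `t ∈ [0,1]`, inside `S`, and `0 < Re(Σᵢ (Fᵢ z₀ − Fᵢ(p + t(q−p)))² + κ G(p + t(q−p)))`
for every `t ∈ [0,1]`: then some `m > 0` is below all these real parts (minimum of a continuous function on `[0,1]`). [folklore] -/
theorem anchor_margin_pos {hs L cc : ℝ} {F : ℂ → (Fin 3 → ℂ)}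
    (hF : DifferentiableOn ℂ F {z : ℂ | |z.im| < hs ∧ |z.re - cc| < L + hs})
    {G : ℂ → ℂ} (hG : ContinuousOn G {z : ℂ | |z.im| < hs ∧ |z.re - cc| < L + hs})
    {p q z₀ : ℂ} (hseg : ∀ t ∈ Icc (0:ℝ) 1, p + (t : ℂ) * (q - p) ∈ {z : ℂ | |z.im| < hs ∧ |z.re - cc| < L + hs})
    {κ : ℝ}
    (hpos : ∀ t ∈ Icc (0:ℝ) 1,
      0 < ((∑ i, (F z₀ i - F (p + (t : ℂ) * (q - p)) i) ^ 2) + (κ : ℂ) * G (p + (t : ℂ) * (q - p))).re) :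
    ∃ m : ℝ, 0 < m ∧ ∀ t ∈ Icc (0:ℝ) 1,
      m ≤ ((∑ i, (F z₀ i - F (p + (t : ℂ) * (q - p)) i) ^ 2) + (κ : ℂ) * G (p + (t : ℂ) * (q - p))).re := by
  set S : Set ℂ := {z : ℂ | |z.im| < hs ∧ |z.re - cc| < L + hs} with hS
  set φ : ℝ → ℝ := fun t =>
    ((∑ i, (F z₀ i - F (p + (t : ℂ) * (q - p)) i) ^ 2) + (κ : ℂ) * G (p + (t : ℂ) * (q - p))).re with hφ
  have hγc : Continuous fun t : ℝ => p + (t : ℂ) * (q - p) :=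
    continuous_const.add (Complex.continuous_ofReal.mul continuous_const)
  have hγS : MapsTo (fun t : ℝ => p + (t : ℂ) * (q - p)) (Icc (0:ℝ) 1) S := fun t ht => hseg t ht
  have hFc : ContinuousOn (fun t : ℝ => F (p + (t : ℂ) * (q - p))) (Icc (0:ℝ) 1) :=
    hF.continuousOn.comp hγc.continuousOn hγS
  have hGc : ContinuousOn (fun t : ℝ => G (p + (t : ℂ) * (q - p))) (Icc (0:ℝ) 1) :=
    hG.comp hγc.continuousOn hγS
  have hφc : ContinuousOn φ (Icc (0:ℝ) 1) := by
    have h1 : ContinuousOn (fun t : ℝ => ∑ i, (F z₀ i - F (p + (t : ℂ) * (q - p)) i) ^ 2) (Icc (0:ℝ) 1) := by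
      refine continuousOn_finsetSum _ fun i _ => ?_
      have hi : ContinuousOn (fun t : ℝ => F (p + (t : ℂ) * (q - p)) i) (Icc (0:ℝ) 1) :=
        (continuous_apply i).comp_continuousOn hFc
      exact (continuousOn_const.sub hi).pow 2
    exact Complex.continuous_re.comp_continuousOn (h1.add (continuousOn_const.mul hGc))
  obtain ⟨t₀, ht₀, hmin⟩ := (isCompact_Icc : IsCompact (Icc (0:ℝ) 1)).exists_isMinOn
    (nonempty_Icc.mpr zero_le_one) hφc
  refine ⟨φ t₀, hpos t₀ ht₀, fun t ht => ?_⟩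
  exact (isMinOn_iff.mp hmin) t ht

/-- **A frozen complex segment of the anchor's tent, on a ball of targets.**  Stadium `S = {|Im| < hs, |Re − cc| < L + hs}`; `F` holomorphic
on `S` with `‖F′‖ ≤ M`; `G` continuous on `S`; anchor `z₀ ∈ S`; source segment `[p, q] ⊆ S`; pointwise positivity at the anchor
`0 < Re(Σᵢ (Fᵢ z₀ − Fᵢ(γ t))² + κ G(γ t))`, `γ t = p + t(q − p)`, `t ∈ [0,1]`.  Then there are `μ > 0` and `δ > 0` with `B(z₀, δ) ⊆ S` such
that (i) the margin `μ ≤ Re(Σᵢ (Fᵢ z − Fᵢ(γ t))² + κ G(γ t))` holds for every target `z ∈ B(z₀, δ)` and `t ∈ [0,1]`; (ii) the frozen piece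
`z ↦ ∫_{t∈[0,1]} ((Σᵢ (Fᵢ z − Fᵢ(γ t))² + κ G(γ t))^{3/2})⁻¹ • (((q−p)•F′(γ t)) ⨯₃ (F z − F(γ t))) dt` is holomorphic on `B(z₀, δ)`;
(iii) it is bounded there by `μ^{-3/2}·2·(‖q − p‖M)·(M(1 + ‖z₀ − p‖ + ‖q − p‖))`.  (`μ = m/2` with `m` from `anchor_margin_pos`,
`δ = min(dist-to-∂S radius, 1, m/(2(3M²(1 + 2(‖z₀−p‖+‖q−p‖)) + 1)))`.) [folklore] -/
theorem frozenSegment_nhds {hs L cc M : ℝ} {F : ℂ → (Fin 3 → ℂ)}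
    (hF : DifferentiableOn ℂ F {z : ℂ | |z.im| < hs ∧ |z.re - cc| < L + hs})
    (hM : ∀ z ∈ {z : ℂ | |z.im| < hs ∧ |z.re - cc| < L + hs}, ‖deriv F z‖ ≤ M) (hM0 : 0 ≤ M)
    {G : ℂ → ℂ} (hG : ContinuousOn G {z : ℂ | |z.im| < hs ∧ |z.re - cc| < L + hs})
    {p q z₀ : ℂ} (hz₀ : z₀ ∈ {z : ℂ | |z.im| < hs ∧ |z.re - cc| < L + hs})
    (hseg : ∀ t ∈ Icc (0:ℝ) 1, p + (t : ℂ) * (q - p) ∈ {z : ℂ | |z.im| < hs ∧ |z.re - cc| < L + hs})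
    {κ : ℝ}
    (hpos : ∀ t ∈ Icc (0:ℝ) 1,
      0 < ((∑ i, (F z₀ i - F (p + (t : ℂ) * (q - p)) i) ^ 2) + (κ : ℂ) * G (p + (t : ℂ) * (q - p))).re) :
    ∃ μ δ : ℝ, 0 < μ ∧ 0 < δ ∧ ball z₀ δ ⊆ {z : ℂ | |z.im| < hs ∧ |z.re - cc| < L + hs} ∧
      (∀ z ∈ ball z₀ δ, ∀ t ∈ Icc (0:ℝ) 1,
        μ ≤ ((∑ i, (F z i - F (p + (t : ℂ) * (q - p)) i) ^ 2) + (κ : ℂ) * G (p + (t : ℂ) * (q - p))).re) ∧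
      DifferentiableOn ℂ (fun z => ∫ t in Icc (0:ℝ) 1,
        (((∑ i, (F z i - F (p + (t : ℂ) * (q - p)) i) ^ 2) + (κ : ℂ) * G (p + (t : ℂ) * (q - p))) ^ ((3:ℂ) / 2))⁻¹ •
          (((q - p) • deriv F (p + (t : ℂ) * (q - p))) ⨯₃ (fun i => F z i - F (p + (t : ℂ) * (q - p)) i))) (ball z₀ δ) ∧
      (∀ z ∈ ball z₀ δ, ‖∫ t in Icc (0:ℝ) 1,
        (((∑ i, (F z i - F (p + (t : ℂ) * (q - p)) i) ^ 2) + (κ : ℂ) * G (p + (t : ℂ) * (q - p))) ^ ((3:ℂ) / 2))⁻¹ •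
          (((q - p) • deriv F (p + (t : ℂ) * (q - p))) ⨯₃ (fun i => F z i - F (p + (t : ℂ) * (q - p)) i))‖ ≤
        μ ^ (-(3/2 : ℝ)) * (2 * (‖q - p‖ * M) * (M * (1 + (‖z₀ - p‖ + ‖q - p‖))))) := by
  set S : Set ℂ := {z : ℂ | |z.im| < hs ∧ |z.re - cc| < L + hs} with hS
  obtain ⟨m, hm, hmt⟩ := anchor_margin_pos hF hG hseg hpos
  -- a ball of targets inside the (open) stadium
  obtain ⟨ε, hε, hεS⟩ := Metric.isOpen_iff.mp (isOpen_stadium hs (L + hs) cc) z₀ hz₀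
  -- the distance from the anchor to the segment
  set R₀ : ℝ := ‖z₀ - p‖ + ‖q - p‖ with hR₀def
  have hR₀ : 0 ≤ R₀ := by positivity
  have hdist0 : ∀ t ∈ Icc (0:ℝ) 1, ‖z₀ - (p + (t : ℂ) * (q - p))‖ ≤ R₀ := by
    intro t ht
    have e : z₀ - (p + (t : ℂ) * (q - p)) = (z₀ - p) - (t : ℂ) * (q - p) := by ring
    rw [e]
    have ht1 : ‖(t : ℂ) * (q - p)‖ ≤ ‖q - p‖ := by
      rw [norm_mul, Complex.norm_real, Real.norm_eq_abs, abs_of_nonneg ht.1]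
      have := ht.2
      nlinarith [norm_nonneg (q - p)]
    exact (norm_sub_le _ _).trans (by linarith)
  -- the freeze radius
  set K : ℝ := 3 * M ^ 2 * (1 + 2 * R₀) + 1 with hK
  have hKpos : 0 < K := by positivity
  set δ : ℝ := min ε (min 1 (m / (2 * K))) with hδ
  have hδpos : 0 < δ := lt_min hε (lt_min one_pos (by positivity))
  have hδε : δ ≤ ε := min_le_left _ _
  have hδ1 : δ ≤ 1 := (min_le_right _ _).trans (min_le_left _ _)
  have hδm : δ ≤ m / (2 * K) := (min_le_right _ _).trans (min_le_right _ _)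
  have hballS : ball z₀ δ ⊆ S := (ball_subset_ball hδε).trans hεS
  -- (i) the margin `m/2` on the ball
  have hmargin : ∀ z ∈ ball z₀ δ, ∀ t ∈ Icc (0:ℝ) 1,
      m / 2 ≤ ((∑ i, (F z i - F (p + (t : ℂ) * (q - p)) i) ^ 2) + (κ : ℂ) * G (p + (t : ℂ) * (q - p))).re := by
    intro z hz t ht
    have hzS : z ∈ S := hballS hz
    have hzz₀ : ‖z - z₀‖ < δ := by rwa [mem_ball, dist_eq_norm] at hz
    have hζS := hseg t ht
    have h0 := hdist0 t ht
    have h1 : ‖z - (p + (t : ℂ) * (q - p))‖ ≤ 1 + R₀ := by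
      have e : z - (p + (t : ℂ) * (q - p)) = (z - z₀) + (z₀ - (p + (t : ℂ) * (q - p))) := by ring
      rw [e]
      exact (norm_add_le _ _).trans (add_le_add (hzz₀.le.trans hδ1) h0)
    have hnear : 3 * M ^ 2 * ‖z - z₀‖ * (‖z - (p + (t : ℂ) * (q - p))‖ + ‖z₀ - (p + (t : ℂ) * (q - p))‖) ≤ m / 2 := by
      have hsum : ‖z - (p + (t : ℂ) * (q - p))‖ + ‖z₀ - (p + (t : ℂ) * (q - p))‖ ≤ 1 + 2 * R₀ := by linarith
      have hM2 : 0 ≤ 3 * M ^ 2 := by positivity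
      calc 3 * M ^ 2 * ‖z - z₀‖ * (‖z - (p + (t : ℂ) * (q - p))‖ + ‖z₀ - (p + (t : ℂ) * (q - p))‖)
          ≤ 3 * M ^ 2 * δ * (1 + 2 * R₀) := by
            apply mul_le_mul (mul_le_mul_of_nonneg_left hzz₀.le hM2) hsum (by positivity) (by positivity)
        _ ≤ K * δ := by rw [hK]; nlinarith [hδpos.le]
        _ ≤ K * (m / (2 * K)) := mul_le_mul_of_nonneg_left hδm hKpos.le
        _ = m / 2 := by field_simp
    exact re_chord_sq_core_ge_of_near hF hM hM0 hzS hz₀ hζS (C := (κ : ℂ) * G (p + (t : ℂ) * (q - p))) (hmt t ht) hnear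
  have hμ : 0 < m / 2 := half_pos hm
  -- bookkeeping for `Theorems.StadiumSegmentPiece`
  have hseg' : ∀ t : ℝ, p + (↑(max 0 (min t 1)) : ℂ) * (q - p) ∈ S :=
    fun t => hseg _ ⟨le_max_left _ _, max_le zero_le_one (min_le_right _ _)⟩
  have hM' : ∀ t ∈ Icc (0:ℝ) 1, ‖deriv F (p + (t : ℂ) * (q - p))‖ ≤ M := fun t ht => hM _ (hseg t ht)
  have hR : ∀ z ∈ ball z₀ δ, ∀ t ∈ Icc (0:ℝ) 1, ‖F z - F (p + (t : ℂ) * (q - p))‖ ≤ M * (1 + R₀) := by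
    intro z hz t ht
    have hzS : z ∈ S := hballS hz
    have hzz₀ : ‖z - z₀‖ < δ := by rwa [mem_ball, dist_eq_norm] at hz
    have h1 : ‖z - (p + (t : ℂ) * (q - p))‖ ≤ 1 + R₀ := by
      have e : z - (p + (t : ℂ) * (q - p)) = (z - z₀) + (z₀ - (p + (t : ℂ) * (q - p))) := by ring
      rw [e]
      exact (norm_add_le _ _).trans (add_le_add (hzz₀.le.trans hδ1) (hdist0 t ht))
    have h := (component_lipschitz hF hM hzS (hseg t ht)).1
    exact h.trans (mul_le_mul_of_nonneg_left h1 hM0)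
  refine ⟨m / 2, δ, hμ, hδpos, hballS, hmargin, ?_, ?_⟩
  · exact segmentPiece_differentiableOn (isOpen_stadium hs (L + hs) cc) isOpen_ball hballS hF hG hseg' hμ hmargin hM' hR
  · intro z hz
    exact segmentPiece_norm_le hμ hmargin hM' hR hz

end Summit.NavierStokesRegularity.NavierStokesRegularity.Theorems.StadiumFrozenSegmentNhds

end
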